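import Summits.CriticalPhenomena.PercolationContinuityZ3.Theorems.Transplant.KNCells2RootChain
import Summits.CriticalPhenomena.PercolationContinuityZ3.Theorems.Transplant.KNCellsStepsSubbox
import HarnessLib

/-!
# Design (D), D8: the root law `W0root` (root cube wired, restricted to the root world `Q_0 ∪ E_{0,du}`) — finite support, its values on fresh
# pairs, and the SUBBOX PROPERTY of the fresh regions of the root chain in an auxiliary graph `G' ≤ G` (e.g. the tube graph)
# (companion of `isSubbox_Wcor_graph` (p217063) / `isSubbox_Wt_graph` (p217253) for the root probe `hQ0`; lead 14:31:12Z residue list)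

builds on p205010 (kernel theorem, internal audit signed; external expert review pending) — nothing in this file uses p205010.
Lane `prim-bschramm`, seat `prim-bschramm-p2` (D8); helper file (`--supports stmt-CriticalPhenomena-4575`).

* `finSupp_W0root` (support `U0root du`), `W0root_apply_of_mem` (a pair inside the root world which is not an edge of the root cube has the
  graph weight), **`isSubbox_W0root_graph`** (`Dd ⊆ U0root du` disjoint from the root cube `Q_{a₀,0}`, `G`-edges inside `Dd` are `G'`-edges,
  `G`-edges from `U0root \ Dd` into `Dd` are `G'`-edges ⟹ `IsSubbox G' (W0root du) p Dd`); the same three for `W0sub U'`.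
[cite: KozmaNitzan2024, §4 p. 17 (subbox), p. 27 (G₀), p. 28]
-/

noncomputable section

open MeasureTheory ProbabilityTheory
open scoped ENNReal Classical

namespace Summit.CriticalPhenomena.PercolationContinuityZ3.Theorems

namespace Transplant

namespace KNCells

open Literature.Probability.Percolation Literature.Probability.LatticeModels SimpleGraph GadgetSystem ProbeHistory HSiteScheme Contour

variable {V : Type*} [DecidableEq V] [Countable V]

namespace KSchA

variable {A : Type*} {G : SimpleGraph V} [G.LocallyFinite] {S : KSchA V A} {du : MDir}

omit [Countable V] in
/-- `W0root` is finitely supported on the root world. [folklore] -/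
theorem finSupp_W0root : KNLevels.FinSupp (S.W0root G du) (S.U0root du) := by
  unfold W0root; exact finSupp_restrW _ _

omit [Countable V] in
/-- On a pair inside the root world which is not an edge of the root cube, `W0root` is the graph weighting. [folklore] -/
theorem W0root_apply_of_mem {x : Sym2 V} (hxU : x ∈ wireSet (↑(S.U0root du) : Set V)) (hxF : x ∉ S.U₀ G) :
    S.W0root G du x = KNLevels.lattW G S.p x := by
  unfold W0root
  rw [restrW_apply_of_mem _ hxU, pinW_apply_of_not_mem _ _ (fun h' => hxF (Finset.mem_coe.1 h'))]

omit [Countable V] in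
/-- **`W0root` is a subbox weighting of a subgraph structure `G' ≤ G` on every `Dd ⊆ U0root du` disjoint from the root cube** (inside `Dd`
the `G`-edges are `G'`-edges; `G`-edges from `U0root \ Dd` into `Dd` are `G'`-edges). [cite: KozmaNitzan2024, §4 p. 17, p. 28] -/
theorem isSubbox_W0root_graph (G' : SimpleGraph V) [G'.LocallyFinite] (hle : G' ≤ G)
    {Dd : Finset V} (hDU : Dd ⊆ S.U0root du) (hdis : Disjoint Dd (S.Γ.Q S.Γ.a₀ 0))
    (hin : ∀ u ∈ Dd, ∀ v ∈ Dd, G.Adj u v → G'.Adj u v)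
    (hout : ∀ v ∈ Dd, ∀ x ∈ S.U0root du, x ∉ Dd → G.Adj x v → G'.Adj x v) :
    KNLevels.IsSubbox G' (S.W0root G du) S.p Dd := by
  have hfresh : ∀ u ∈ Dd, ∀ z, s(u, z) ∉ S.U₀ G := fun u hu z h' => by
    rw [U₀, mem_edgesIn_iff] at h'
    exact Finset.disjoint_left.1 hdis hu (h'.2 u (Sym2.mem_mk_left _ _))
  refine ⟨fun u hu v hv huv => ?_, fun u hu v hv hne huv => ?_, fun v hv hvb x hx => ?_⟩
  · have huv' : G.Adj u v := hle huv
    rw [W0root_apply_of_mem (mk_mem_wireSet_iff.2 ⟨Finset.mem_coe.2 (hDU hu), Finset.mem_coe.2 (hDU hv), huv'.ne⟩) (hfresh u hu v),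
      KNLevels.lattW_apply, if_pos ((SimpleGraph.mem_edgeSet G).2 huv')]
  · have huv' : ¬G.Adj u v := fun h' => huv (hin u hu v hv h')
    rw [W0root_apply_of_mem (mk_mem_wireSet_iff.2 ⟨Finset.mem_coe.2 (hDU hu), Finset.mem_coe.2 (hDU hv), hne⟩) (hfresh u hu v),
      KNLevels.lattW_apply, if_neg (fun h' => huv' ((SimpleGraph.mem_edgeSet G).1 h'))]
  · by_cases hxU : s(x, v) ∈ wireSet (↑(S.U0root du) : Set V)
    · have hxU' : x ∈ S.U0root du := Finset.mem_coe.1 (hxU.1 x (Sym2.mem_mk_left _ _))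
      have hnadj : ¬G.Adj x v := fun hadj =>
        hvb ((mem_innerBoundary_iff).2 ⟨hv, x, hx, (hout v hv x hxU' hx hadj).symm⟩)
      rw [Sym2.eq_swap] at hxU
      rw [Sym2.eq_swap, W0root_apply_of_mem hxU (hfresh v hv x), KNLevels.lattW_apply,
        if_neg (fun h' => hnadj ((SimpleGraph.mem_edgeSet G).1 h').symm)]
    · unfold W0root; exact restrW_apply_of_not_mem _ hxU

/-! ## The same for the law restricted to a sub-world -/

omit [Countable V] in
/-- `W0sub U'` is finitely supported on `U'`. [folklore] -/
theorem finSupp_W0sub {U' : Finset V} : KNLevels.FinSupp (S.W0sub G U') U' := by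
  unfold W0sub; exact finSupp_restrW _ _

omit [Countable V] in
/-- On a pair inside `U'` which is not an edge of the root cube, `W0sub U'` is the graph weighting. [folklore] -/
theorem W0sub_apply_of_mem {U' : Finset V} {x : Sym2 V} (hxU : x ∈ wireSet (↑U' : Set V)) (hxF : x ∉ S.U₀ G) :
    S.W0sub G U' x = KNLevels.lattW G S.p x := by
  unfold W0sub
  rw [restrW_apply_of_mem _ hxU, pinW_apply_of_not_mem _ _ (fun h' => hxF (Finset.mem_coe.1 h'))]

omit [Countable V] in
/-- **`W0sub U'` is a subbox weighting of a subgraph structure `G' ≤ G` on every `Dd ⊆ U'` disjoint from the root cube** (inside `Dd` the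
`G`-edges are `G'`-edges; `G`-edges from `U' \ Dd` into `Dd` are `G'`-edges). [cite: KozmaNitzan2024, §4 p. 17, p. 28] -/
theorem isSubbox_W0sub_graph (G' : SimpleGraph V) [G'.LocallyFinite] (hle : G' ≤ G) {U' : Finset V}
    {Dd : Finset V} (hDU : Dd ⊆ U') (hdis : Disjoint Dd (S.Γ.Q S.Γ.a₀ 0))
    (hin : ∀ u ∈ Dd, ∀ v ∈ Dd, G.Adj u v → G'.Adj u v)
    (hout : ∀ v ∈ Dd, ∀ x ∈ U', x ∉ Dd → G.Adj x v → G'.Adj x v) :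
    KNLevels.IsSubbox G' (S.W0sub G U') S.p Dd := by
  have hfresh : ∀ u ∈ Dd, ∀ z, s(u, z) ∉ S.U₀ G := fun u hu z h' => by
    rw [U₀, mem_edgesIn_iff] at h'
    exact Finset.disjoint_left.1 hdis hu (h'.2 u (Sym2.mem_mk_left _ _))
  refine ⟨fun u hu v hv huv => ?_, fun u hu v hv hne huv => ?_, fun v hv hvb x hx => ?_⟩
  · have huv' : G.Adj u v := hle huv
    rw [W0sub_apply_of_mem (mk_mem_wireSet_iff.2 ⟨Finset.mem_coe.2 (hDU hu), Finset.mem_coe.2 (hDU hv), huv'.ne⟩) (hfresh u hu v),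
      KNLevels.lattW_apply, if_pos ((SimpleGraph.mem_edgeSet G).2 huv')]
  · have huv' : ¬G.Adj u v := fun h' => huv (hin u hu v hv h')
    rw [W0sub_apply_of_mem (mk_mem_wireSet_iff.2 ⟨Finset.mem_coe.2 (hDU hu), Finset.mem_coe.2 (hDU hv), hne⟩) (hfresh u hu v),
      KNLevels.lattW_apply, if_neg (fun h' => huv' ((SimpleGraph.mem_edgeSet G).1 h'))]
  · by_cases hxU : s(x, v) ∈ wireSet (↑U' : Set V)
    · have hxU' : x ∈ U' := Finset.mem_coe.1 (hxU.1 x (Sym2.mem_mk_left _ _))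
      have hnadj : ¬G.Adj x v := fun hadj =>
        hvb ((mem_innerBoundary_iff).2 ⟨hv, x, hx, (hout v hv x hxU' hx hadj).symm⟩)
      rw [Sym2.eq_swap] at hxU
      rw [Sym2.eq_swap, W0sub_apply_of_mem hxU (hfresh v hv x), KNLevels.lattW_apply,
        if_neg (fun h' => hnadj ((SimpleGraph.mem_edgeSet G).1 h').symm)]
    · unfold W0sub; exact restrW_apply_of_not_mem _ hxU

end KSchA

end KNCells

end Transplant

end Summit.CriticalPhenomena.PercolationContinuityZ3.Theorems

end
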